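import Summits.CriticalPhenomena.Ising3DConformalLimit.Theorems.PrecisionLaplacianDirectCorrelationStableTailSlabFunctionalLimitAux

/-!
# Stub `stub_slabFunctionalLimit`: 3-d vague scaling ⇒ convergence of the slab-sum functionals

Line `self-energy-pick-inversion`, crux `PrecisionLaplacian.DirectCorrelationStableTail`
(stmt-CriticalPhenomena-4799).  Pure theorem file, Ising-free.

Let `a : ℤ³ → ℝ` be summable, even, nonnegative off the origin, let `Ψ` be integrable away from the
origin and suppose the STABLE SCALING `R^α Σ_x a(x) f(x/R) → ∫ f Ψ` for every continuous compactly
supported `f` vanishing near `0`.  Then for every continuous `g` compactly supported in `(0, ∞)` the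
slab-sum functionals converge:
`R^α Σ_{n ≥ 0} S⁽ⁱ⁾(n) g(n/R) → ½ ∫ g(|y_i|) Ψ(y) dy`, `S⁽ⁱ⁾(n) = Σ_{y ∈ ℤ²} a(ins_i(n, y))`.

Proof (`stub_slabFunctionalLimit`):
* slab regrouping (`tsum_mul_eq_two_mul_tsum_slab`): `Σ_x a(x) g(|x_i|/R) = 2 Σ_n S⁽ⁱ⁾(n) g(n/R)`;
* cut-off: `f_K(u) = g(|u_i|) χ_K(u)` with `χ_K = 1` on `‖u‖ ≤ K + 1`, `= 0` off `‖u‖ ≤ 2(K + 1)` is an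
  admissible test function, and `|Σ_x a(x)(g(|x_i|/R) - f_K(x/R))| ≤ ‖g‖_∞ Σ_{‖x‖ > (K+1)R} a(x)
  ≤ ‖g‖_∞ C (K+1)^{-α} R^{-α}` by the dyadic tail bound `stub_slabFunctionalLimit_auxTail`;
* `∫ f_K Ψ → ∫ g(|y_i|) Ψ` by dominated convergence (`g(|y_i|) ≠ 0 ⇒ ‖y‖ ≥ δ`), and an `ε/3` assembly.
-/

noncomputable section

namespace Summit.CriticalPhenomena.Ising3DConformalLimit.Cruxes.DirectCorrelationStableTail.SelfEnergyPickInversion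

open Filter Topology MeasureTheory Literature.Probability.LatticeModels
open scoped BigOperators

/-! ### Test functions supported away from zero, cut-offs, an `ε/3` lemma -/

/-- A function whose topological support lies in `(0, ∞)` vanishes on `(-∞, δ)` for some `δ > 0`.
[folklore] -/
theorem exists_pos_eq_zero_of_tsupport_subset_Ioi {g : ℝ → ℝ} (hgs : tsupport g ⊆ Set.Ioi 0) :
    ∃ δ : ℝ, 0 < δ ∧ ∀ u : ℝ, u < δ → g u = 0 := by
  have h0 : (0 : ℝ) ∉ tsupport g := fun h => lt_irrefl (0 : ℝ) (hgs h)
  rw [notMem_tsupport_iff_eventuallyEq] at h0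
  obtain ⟨ε, hε, hball⟩ := Metric.eventually_nhds_iff_ball.1 h0
  refine ⟨ε, hε, fun u hu => ?_⟩
  rcases le_or_gt u 0 with hu0 | hu0
  · exact image_eq_zero_of_notMem_tsupport fun h => not_lt.2 hu0 (hgs h)
  · exact hball u (by rw [Metric.mem_ball, Real.dist_eq, sub_zero, abs_of_pos hu0]; exact hu)

/-- The cut-off `χ_k(u) = max 0 (min 1 (2 - ‖u‖ / k))` lies in `[0, 1]`. [folklore] -/
theorem abs_one_sub_maxMinCutoff_le (t : ℝ) : |1 - max 0 (min 1 t)| ≤ 1 := by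
  rw [abs_le]
  constructor
  · linarith [max_le zero_le_one (min_le_left 1 t)]
  · linarith [le_max_left 0 (min 1 t)]

/-- The cut-off `χ_k(u) = max 0 (min 1 (2 - ‖u‖ / k))` has absolute value at most `1`. [folklore] -/
theorem abs_maxMinCutoff_le (t : ℝ) : |max 0 (min 1 t)| ≤ 1 := by
  rw [abs_of_nonneg (le_max_left _ _)]
  exact max_le zero_le_one (min_le_left 1 t)

/-- The cut-off `χ_k(u) = max 0 (min 1 (2 - s / k))` equals `1` for `s ≤ k`, `k > 0`. [folklore] -/
theorem maxMinCutoff_eq_one {s k : ℝ} (hk : 0 < k) (hs : s ≤ k) : max 0 (min 1 (2 - s / k)) = 1 := by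
  have : 1 ≤ 2 - s / k := by
    have := (div_le_one hk).2 hs
    linarith
  rw [min_eq_left this, max_eq_right zero_le_one]

/-- The cut-off `χ_k(u) = max 0 (min 1 (2 - s / k))` vanishes for `s ≥ 2k`, `k > 0`. [folklore] -/
theorem maxMinCutoff_eq_zero {s k : ℝ} (hk : 0 < k) (hs : 2 * k ≤ s) : max 0 (min 1 (2 - s / k)) = 0 := by
  refine max_eq_left ((min_le_right _ _).trans ?_)
  rw [sub_nonpos, le_div_iff₀ hk]
  exact hs

/-- **`ε/3` assembly.** If `u_K → ℓ`, `v_{K,R} → u_K` as `R → ∞` for every `K`, and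
`|w_R - v_{K,R}| ≤ c_K` for all `R ≥ 1` with `c_K → 0`, then `w_R → ℓ`. [folklore] -/
theorem tendsto_of_cutoff_approx_thirds {w : ℕ → ℝ} {v : ℕ → ℕ → ℝ} {u c : ℕ → ℝ} {ℓ : ℝ}
    (hu : Tendsto u atTop (𝓝 ℓ)) (hv : ∀ K, Tendsto (v K) atTop (𝓝 (u K)))
    (hc : Tendsto c atTop (𝓝 0)) (hwv : ∀ K R, 1 ≤ R → |w R - v K R| ≤ c K) :
    Tendsto w atTop (𝓝 ℓ) := by
  rw [Metric.tendsto_atTop]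
  intro ε hε
  have hε3 : 0 < ε / 3 := by positivity
  obtain ⟨K, hK1, hK2⟩ :=
    ((Metric.tendsto_nhds.1 hc (ε / 3) hε3).and (Metric.tendsto_nhds.1 hu (ε / 3) hε3)).exists
  obtain ⟨N, hN⟩ := Metric.tendsto_atTop.1 (hv K) (ε / 3) hε3
  refine ⟨max N 1, fun R hR => ?_⟩
  have h1 := hwv K R (le_of_max_le_right hR)
  have h2 := hN R (le_of_max_le_left hR)
  rw [Real.dist_eq] at h2 hK2 ⊢
  rw [Real.dist_0_eq_abs] at hK1
  have h3 := abs_add_three (w R - v K R) (v K R - u K) (u K - ℓ)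
  have h4 : w R - ℓ = (w R - v K R) + (v K R - u K) + (u K - ℓ) := by ring
  rw [h4]
  have h5 : c K < ε / 3 := lt_of_abs_lt hK1
  linarith

/-! ### The stub -/

/-- **Stub `stub_slabFunctionalLimit`** (Ising-free; 3-d vague scaling ⇒ 1-d slab functionals): let
`a : ℤ³ → ℝ` be `≥ 0` off `0`, summable and even, let `Ψ` be integrable away from the origin, and
suppose `R^α Σ_x a(x) f(x/R) → ∫ f Ψ` for every `f ∈ C_c(ℝ³ ∖ 0)`.  Then for every continuous `g`
compactly supported in `(0,∞)` the slab-sum functionals converge: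
`R^α Σ_{n ≥ 0} S⁽ⁱ⁾(n) g(n/R) → ½ ∫ g(|y_i|) Ψ(y) dy`, `S⁽ⁱ⁾(n) = Σ_{y ∈ ℤ²} a(ins_i(n, y))`.
Proof: slab regrouping `Σ_x a(x) g(|x_i|/R) = 2 Σ_n S⁽ⁱ⁾(n) g(n/R)`; cut off with `χ_K(u)`, the error
being `≤ ‖g‖_∞ Σ_{‖x‖ > (K+1)R} a(x) ≤ ‖g‖_∞ C (K+1)^{-α} R^{-α}` by the dyadic tail bound; let
`R → ∞`, then `K → ∞` by dominated convergence. [folklore] -/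
theorem stub_slabFunctionalLimit : ∀ (a : Site 3 → ℝ) (α : ℝ) (Ψ : (Fin 3 → ℝ) → ℝ) (i : Fin 3), 0 < α → (∀ x : Site 3, x ≠ 0 → 0 ≤ a x) → Summable a → (∀ x : Site 3, a (-x) = a x) → (∀ δ : ℝ, 0 < δ → MeasureTheory.IntegrableOn Ψ {y : Fin 3 → ℝ | δ ≤ ‖y‖}) → (∀ f : (Fin 3 → ℝ) → ℝ, Continuous f → HasCompactSupport f → (0 : Fin 3 → ℝ) ∉ tsupport f → Filter.Tendsto (fun R : ℕ => (R : ℝ) ^ α * ∑' x : Site 3, a x * f (fun j => (x j : ℝ) / (R : ℝ))) Filter.atTop (nhds (∫ y : Fin 3 → ℝ, f y * Ψ y))) → ∀ g : ℝ → ℝ, Continuous g → HasCompactSupport g → tsupport g ⊆ Set.Ioi 0 → Filter.Tendsto (fun R : ℕ => (R : ℝ) ^ α * ∑' n : ℕ, (∑' y : Fin 2 → ℤ, a (Fin.insertNth i (n : ℤ) (y) : Site 3)) * g ((n : ℝ) / (R : ℝ))) Filter.atTop (nhds ((1 / 2 : ℝ) * ∫ y : Fin 3 → ℝ, g (|y i|)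 * Ψ y)) := by
  intro a α Ψ i hα ha0 ha haev hΨ hlim g hg hgc hgs
  -- Step 0: the test function `g`
  obtain ⟨δ, hδ, hgδ⟩ := exists_pos_eq_zero_of_tsupport_subset_Ioi hgs
  obtain ⟨M, hM⟩ := hg.bounded_above_of_compact_support hgc
  have hM0 : 0 ≤ M := (norm_nonneg _).trans (hM 0)
  have hg0 : g 0 = 0 := hgδ 0 hδ
  -- Step 1: the dyadic tail bound
  obtain ⟨C, hC⟩ := stub_slabFunctionalLimit_auxTail a α Ψ hα ha0 ha hlim
  -- Step 2: slab regrouping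
  have hslab : ∀ R : ℕ,
      ∑' n : ℕ, (∑' y : Fin 2 → ℤ, a (Fin.insertNth i (n : ℤ) (y) : Site 3)) * g ((n : ℝ) / (R : ℝ)) =
        (1 / 2 : ℝ) * ∑' x : Site 3, a x * g (|(x i : ℝ)| / (R : ℝ)) := by
    intro R
    have h := tsum_mul_eq_two_mul_tsum_slab ha haev i (h := fun n : ℤ => g (|(n : ℝ)| / (R : ℝ)))
      (M := M) (fun n => by simpa only [Real.norm_eq_abs] using hM _) (fun n => by simp) (by simp [hg0])
    rw [h]
    simp only [Int.cast_natCast, Nat.abs_cast]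
    ring
  -- Step 3: the cut-off test functions `f_K(u) = g(|u_i|) χ_{K+1}(u)`
  set fK : ℕ → (Fin 3 → ℝ) → ℝ :=
    fun K u => g (|u i|) * max 0 (min 1 (2 - ‖u‖ / ((K : ℝ) + 1))) with hfK
  have hfKc : ∀ K, Continuous (fK K) := fun K =>
    (hg.comp (continuous_abs.comp (continuous_apply i))).mul
      (continuous_const.max (continuous_const.min (by fun_prop)))
  have hfKle : ∀ K u, ‖fK K u‖ ≤ M := fun K u => by
    simp only [hfK, norm_mul, Real.norm_eq_abs]
    calc |g (|u i|)| * |max 0 (min 1 (2 - ‖u‖ / ((K : ℝ) + 1)))| ≤ M * 1 :=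
          mul_le_mul ((Real.norm_eq_abs _).symm.trans_le (hM _)) (abs_maxMinCutoff_le _) (abs_nonneg _) hM0
      _ = M := mul_one M
  have hfKs : ∀ K, HasCompactSupport (fK K) := fun K => by
    refine HasCompactSupport.intro (isCompact_closedBall (0 : Fin 3 → ℝ) (2 * ((K : ℝ) + 1)))
      fun u hu => ?_
    rw [Metric.mem_closedBall, dist_zero_right, not_le] at hu
    simp only [hfK]
    rw [maxMinCutoff_eq_zero (by positivity) hu.le, mul_zero]
  have hfKt : ∀ K, (0 : Fin 3 → ℝ) ∉ tsupport (fK K) := fun K => by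
    rw [notMem_tsupport_iff_eventuallyEq]
    filter_upwards [Metric.ball_mem_nhds (0 : Fin 3 → ℝ) hδ] with u hu
    rw [Metric.mem_ball, dist_zero_right] at hu
    simp only [hfK]
    rw [hgδ _ (lt_of_le_of_lt ((Real.norm_eq_abs _).symm.trans_le (norm_le_pi_norm u i)) hu),
      zero_mul, Pi.zero_apply]
  have hlimK : ∀ K, Tendsto (fun R : ℕ => (R : ℝ) ^ α *
      ∑' x : Site 3, a x * fK K (fun j => (x j : ℝ) / (R : ℝ))) atTop (𝓝 (∫ y, fK K y * Ψ y)) :=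
    fun K => hlim (fK K) (hfKc K) (hfKs K) (hfKt K)
  -- Step 4: the cut-off error, uniformly in `R ≥ 1`
  have herr : ∀ K R : ℕ, 1 ≤ R →
      |(R : ℝ) ^ α * ∑' x : Site 3, a x * g (|(x i : ℝ)| / (R : ℝ)) -
        (R : ℝ) ^ α * ∑' x : Site 3, a x * fK K (fun j => (x j : ℝ) / (R : ℝ))|
        ≤ M * C * ((K : ℝ) + 1) ^ (-α) := by
    intro K R hR
    have hRpos : (0 : ℝ) < R := by exact_mod_cast hR
    have hk : (0 : ℝ) < (K : ℝ) + 1 := by positivity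
    -- pointwise
    have hpt : ∀ x : Site 3,
        ‖a x * g (|(x i : ℝ)| / (R : ℝ)) - a x * fK K (fun j => (x j : ℝ) / (R : ℝ))‖ ≤
          M * (if ((K : ℝ) + 1) * R < ‖x‖ then a x else 0) := by
      intro x
      have hnorm := norm_intCast_div_eq x hRpos
      have hxi : |((x i : ℤ) : ℝ) / (R : ℝ)| = |(x i : ℝ)| / (R : ℝ) := by
        rw [abs_div, abs_of_pos hRpos]
      simp only [hfK, hxi]
      split_ifs with hx
      · have hx0 : x ≠ 0 := by
          rintro rfl
          rw [norm_zero] at hx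
          linarith [mul_pos hk hRpos]
        rw [← mul_sub, norm_mul, Real.norm_eq_abs, abs_of_nonneg (ha0 x hx0), mul_comm]
        refine mul_le_mul_of_nonneg_right ?_ (ha0 x hx0)
        rw [← mul_one_sub, norm_mul, Real.norm_eq_abs, Real.norm_eq_abs]
        calc |g (|(x i : ℝ)| / (R : ℝ))| * |1 - max 0 (min 1 (2 - ‖fun j => (x j : ℝ) / (R : ℝ)‖ /
              ((K : ℝ) + 1)))| ≤ M * 1 :=
              mul_le_mul ((Real.norm_eq_abs _).symm.trans_le (hM _)) (abs_one_sub_maxMinCutoff_le _)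
                (abs_nonneg _) hM0
          _ = M := mul_one M
      · rw [not_lt] at hx
        rw [hnorm, maxMinCutoff_eq_one hk (by rw [div_le_iff₀ hRpos]; exact hx), mul_one, sub_self,
          norm_zero, mul_zero]
    -- summation
    have hs1 : Summable fun x : Site 3 => a x * g (|(x i : ℝ)| / (R : ℝ)) :=
      Summable.of_norm_bounded (ha.norm.mul_right M) fun x => by
        rw [norm_mul]
        exact mul_le_mul_of_nonneg_left (hM _) (norm_nonneg _)
    have hs2 : Summable fun x : Site 3 => a x * fK K (fun j => (x j : ℝ) / (R : ℝ)) :=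
      Summable.of_norm_bounded (ha.norm.mul_right M) fun x => by
        rw [norm_mul]
        exact mul_le_mul_of_nonneg_left (hfKle K (fun j => (x j : ℝ) / (R : ℝ))) (norm_nonneg _)
    have hs3 : Summable fun x : Site 3 => M * (if ((K : ℝ) + 1) * R < ‖x‖ then a x else 0) :=
      (summable_ite_of_summable ha _).mul_left M
    have hs4 : Summable fun x : Site 3 =>
        ‖a x * g (|(x i : ℝ)| / (R : ℝ)) - a x * fK K (fun j => (x j : ℝ) / (R : ℝ))‖ :=
      Summable.of_norm_bounded hs3 fun x => by rw [norm_norm]; exact hpt x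
    rw [← mul_sub, ← hs1.tsum_sub hs2, abs_mul, abs_of_pos (Real.rpow_pos_of_pos hRpos α)]
    have h1 : |∑' x : Site 3, (a x * g (|(x i : ℝ)| / (R : ℝ)) - a x * fK K (fun j => (x j : ℝ) / (R : ℝ)))|
        ≤ ∑' x : Site 3, M * (if ((K : ℝ) + 1) * R < ‖x‖ then a x else 0) := by
      refine le_trans ?_ ((norm_tsum_le_tsum_norm hs4).trans (Summable.tsum_le_tsum hpt hs4 hs3))
      rw [Real.norm_eq_abs]
    have h2 : ∑' x : Site 3, M * (if ((K : ℝ) + 1) * R < ‖x‖ then a x else 0) ≤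
        M * (C * (((K : ℝ) + 1) * R) ^ (-α)) := by
      rw [tsum_mul_left]
      refine mul_le_mul_of_nonneg_left ?_ hM0
      have := hC ((K + 1) * R) (one_le_mul_of_one_le_of_one_le (Nat.le_add_left 1 K) hR)
      push_cast at this
      exact this
    calc (R : ℝ) ^ α * |∑' x : Site 3, (a x * g (|(x i : ℝ)| / (R : ℝ)) -
          a x * fK K (fun j => (x j : ℝ) / (R : ℝ)))|
        ≤ (R : ℝ) ^ α * (M * (C * (((K : ℝ) + 1) * R) ^ (-α))) :=
          mul_le_mul_of_nonneg_left (h1.trans h2) (Real.rpow_nonneg hRpos.le α)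
      _ = M * C * ((K : ℝ) + 1) ^ (-α) := by
          rw [Real.mul_rpow hk.le hRpos.le, Real.rpow_neg hRpos.le]
          field_simp
  -- Step 5: dominated convergence `∫ f_K Ψ → ∫ g(|y_i|) Ψ`
  have hD : MeasurableSet {y : Fin 3 → ℝ | δ ≤ ‖y‖} :=
    (isClosed_le continuous_const continuous_norm).measurableSet
  have hInt : Integrable ({y : Fin 3 → ℝ | δ ≤ ‖y‖}.indicator Ψ) := (hΨ δ hδ).integrable_indicator hD
  have hind : ∀ y : Fin 3 → ℝ, g (|y i|) * Ψ y = g (|y i|) * {y : Fin 3 → ℝ | δ ≤ ‖y‖}.indicator Ψ y := by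
    intro y
    by_cases hy : y ∈ {y : Fin 3 → ℝ | δ ≤ ‖y‖}
    · rw [Set.indicator_of_mem hy]
    · have : g (|y i|) = 0 := hgδ _ (lt_of_le_of_lt
        ((Real.norm_eq_abs _).symm.trans_le (norm_le_pi_norm y i)) (not_le.1 hy))
      rw [this, zero_mul, zero_mul]
  have hDCT : Tendsto (fun K : ℕ => ∫ y, fK K y * Ψ y) atTop (𝓝 (∫ y, g (|y i|) * Ψ y)) := by
    refine tendsto_integral_of_dominated_convergence
      (fun y => M * ‖{y : Fin 3 → ℝ | δ ≤ ‖y‖}.indicator Ψ y‖) ?_ (hInt.norm.const_mul M) ?_ ?_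
    · intro K
      have : (fun y => fK K y * Ψ y) = fun y => (g (|y i|) * {y : Fin 3 → ℝ | δ ≤ ‖y‖}.indicator Ψ y) *
          max 0 (min 1 (2 - ‖y‖ / ((K : ℝ) + 1))) := by
        funext y
        simp only [hfK]
        rw [mul_right_comm, hind y]
      rw [this]
      refine ((hg.comp (continuous_abs.comp (continuous_apply i))).aestronglyMeasurable.mul
        hInt.aestronglyMeasurable).mul (Continuous.aestronglyMeasurable ?_)
      exact continuous_const.max (continuous_const.min (by fun_prop))
    · intro K
      refine Eventually.of_forall fun y => ?_
      simp only [hfK]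
      rw [mul_right_comm, hind y, norm_mul, norm_mul, Real.norm_eq_abs (max 0 _)]
      calc ‖g (|y i|)‖ * ‖{y : Fin 3 → ℝ | δ ≤ ‖y‖}.indicator Ψ y‖ *
            |max 0 (min 1 (2 - ‖y‖ / ((K : ℝ) + 1)))|
          ≤ M * ‖{y : Fin 3 → ℝ | δ ≤ ‖y‖}.indicator Ψ y‖ * 1 := by
            gcongr
            · exact hM _
            · exact abs_maxMinCutoff_le _
        _ = M * ‖{y : Fin 3 → ℝ | δ ≤ ‖y‖}.indicator Ψ y‖ := mul_one _
    · refine Eventually.of_forall fun y => ?_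
      refine tendsto_atTop_of_eventually_const (i₀ := ⌈‖y‖⌉₊) fun K hK => ?_
      simp only [hfK]
      rw [maxMinCutoff_eq_one (by positivity) ?_, mul_one]
      have h1 : (⌈‖y‖⌉₊ : ℝ) ≤ K := by exact_mod_cast hK
      linarith [Nat.le_ceil ‖y‖]
  -- Step 6: assembly
  have hKlim : Tendsto (fun K : ℕ => M * C * ((K : ℝ) + 1) ^ (-α)) atTop (𝓝 0) := by
    have h1 : Tendsto (fun K : ℕ => (K : ℝ) + 1) atTop atTop :=
      tendsto_natCast_atTop_atTop.atTop_add tendsto_const_nhds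
    simpa only [Function.comp_def, mul_zero] using
      ((tendsto_rpow_neg_atTop hα).comp h1).const_mul (M * C)
  have key : Tendsto (fun R : ℕ => (R : ℝ) ^ α * ∑' x : Site 3, a x * g (|(x i : ℝ)| / (R : ℝ))) atTop
      (𝓝 (∫ y : Fin 3 → ℝ, g (|y i|) * Ψ y)) :=
    tendsto_of_cutoff_approx_thirds
      (w := fun R : ℕ => (R : ℝ) ^ α * ∑' x : Site 3, a x * g (|(x i : ℝ)| / (R : ℝ)))
      (v := fun K R : ℕ => (R : ℝ) ^ α * ∑' x : Site 3, a x * fK K (fun j => (x j : ℝ) / (R : ℝ)))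
      (u := fun K : ℕ => ∫ y, fK K y * Ψ y) (c := fun K : ℕ => M * C * ((K : ℝ) + 1) ^ (-α))
      hDCT hlimK hKlim herr
  refine (key.const_mul (1 / 2 : ℝ)).congr fun R => ?_
  rw [hslab R]
  ring

end Summit.CriticalPhenomena.Ising3DConformalLimit.Cruxes.DirectCorrelationStableTail.SelfEnergyPickInversion

end
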